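import Summits.HodgeConjecture.HodgeConjecture.Theorems.Ring2WeilCoverageCyclicPlacement
import Summits.HodgeConjecture.HodgeConjecture.Theorems.Ring2WeilCoverageNormTableB
import HarnessLib

/-!
# Weil-type family coverage — cyclotomic classes, part B: `ℚ(√-7)`, `ℚ(√-11)`, `ℚ(i)` and `ℚ(√-3)` with three primes

research route conditional on HC_CM; not a corollary; Q11.4-sentence-2 already refuted in dim ≥ 3.

Ring 2, WEIL-TYPE FAMILY-COVERAGE CENSUS (`HOME/WEIL-FAMILY-COVERAGE.md` `## b04`, block b04.7 «CYCLIC-PRYM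
PLACEMENT FOR EVERY m», owner ring2-b04). Part A (`Ring2WeilCoverageCyclicPlacement`) proved refinement (R1) of the
placement law on the tree's carriers — an order-free special fibre lies on the split row iff the product of its
polarisation type `d₁⋯d_g` is a norm from `K` — and decided the classes `[2^α 3^β]`, `[3^α 5^β]` modulo
`Nm(ℚ(i)ˣ)`, `Nm(ℚ(√-3)ˣ)`. This part adds the remaining classes met by the cyclic-Prym pieces `B_m` of the
census (every `dᵢ ∣ m`):

* §1 parity bookkeeping: `pow_mul_mem_iff_of_even` / `pow_mul_mem_iff_of_odd` (`c^α·v ∈ Nm ↔ v ∈ Nm` for `α`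
  even, `↔ c·v ∈ Nm` for `α` odd);
* §2 `K = ℚ(√-3)`: `two_pow_mul_five_pow_mem_iff` and `two_pow_mul_three_pow_mul_five_pow_mem_iff`
  (`2^α 3^β 5^γ ∈ Nm ↔ α, γ` both even — pieces with `m ∣ 90`, `m ∈ {15, 30, 45, 60, 90}`),
  `two_pow_mul_three_pow_mul_seven_pow_mem_iff` (`↔ α` even — `m ∈ {21, 42, 84}`);
* §3 `K = ℚ(√-7)`: `two_pow_mul_three_pow_mul_seven_pow_mem_iff` (`↔ β` even — `m ∈ {7, 14, 21, 28, 42, 56, 84}`),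
  `two_pow_mul_five_pow_mul_seven_pow_mem_iff` (`↔ γ` even — `m ∈ {35, 70}`);
* §4 `K = ℚ(√-11)`: `two_pow_mul_three_pow_mul_eleven_pow_mem_iff` (`↔ α` even — `m ∈ {11, 22, 33, 44, 66}`);
* §5 `K = ℚ(i)`: `two_pow_mul_three_pow_mul_five_pow_mem_iff` (`↔ β` even — `m ∣ 60`),
  `two_pow_mul_seven_pow_mem_iff` (`↔ δ` even — `m = 28`), `two_pow_mul_eleven_pow_mem_iff` (`↔ ε` even — `m = 44`);
* §6 two census sentences over part A's bridge `mk_det_eq_splitDiscriminantClass_iff_prod_type_mem_of_index_sq`: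
  `sqrtNeg7_mk_det_eq_split_iff_even_of_type_two_three_seven` (a `ℚ(√-7)`-Weil piece with order-free
  lattice and type `2^α 3^β 7^δ` is SPLIT iff `v₃` is even — the census finds `v₃` even on every `ℤ/7`, `ℤ/14`,
  `ℤ/21`, `ℤ/28`, `ℤ/42`, `ℤ/84` Weil datum, all on split rows) and
  `sqrtNeg11_mk_det_eq_split_iff_even_of_type_two_three_eleven` (a `ℚ(√-11)`-piece of type `2^α 3^β 11^γ` is
  SPLIT iff `v₂` is even — row W10.11.2 = `(5, ℚ(√-11), [-2])` ∋ the `ℤ/22`-curves `(0; 1,11,12,20)`,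
  `(0; 1,11,16,16)` with `v₂ = 5`).

All norm facts are REUSED BY NAME from ring2-b02's `Ring2WeilNormObstructionDescentCensus`
(`three/five_not_mem_norm_seven`, `two_not_mem_norm_eleven`, `two/ten_not_mem_norm_three`, `seven_not_mem_norm_one`)
and ring2-b04 g40's tables (`SqrtNeg7.mem_2/mem_7`, `SqrtNeg11.mem_3/mem_11`, `SqrtNeg1.mem_2/mem_5/not_mem_11`,
`SqrtNeg3.mem_3/mem_7`). No `def`, no named fact, no `sorry`; nothing here is a statement about Hodge classes;
`HC_CM` is used nowhere.

References: [cite: vanGeemen1994HodgeAV, 5.4 and (5.4.1)]; [cite: Serre1973, Ch. III §1].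
-/

set_option linter.dupNamespace false

open Matrix
open Literature.AlgebraicGeometry.Motives (normUnitsSubgroup)
open Literature.AlgebraicGeometry.VanGeemen1994
open Literature.Geometry.Kaehler.ComplexTorus
open Summit.HodgeConjecture.HodgeConjecture.Ring2.Hypotheses
open Summit.HodgeConjecture.HodgeConjecture.Ring2.AbelianAll (weilStdGramMatrix)
open Summit.HodgeConjecture.Ring2WeilNormDescent

namespace Summit.HodgeConjecture.HodgeConjecture.Ring2.WeilCoverage

/-! ### §1 Parity bookkeeping -/

/-- `c^α · v ∈ Nm(K_dˣ) ↔ v ∈ Nm(K_dˣ)` for `α` even (`c^α` is a square).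
research route conditional on HC_CM; not a corollary; Q11.4-sentence-2 already refuted in dim ≥ 3. [folklore] -/
theorem pow_mul_mem_iff_of_even {d : ℕ} {c : ℚ} (hc : c ≠ 0) {α : ℕ} (hα : Even α) (v : ℚˣ) :
    Units.mk0 (c ^ α) (pow_ne_zero α hc) * v ∈ normUnitsSubgroup ℚ (weilField d) ↔
      v ∈ normUnitsSubgroup ℚ (weilField d) := by
  obtain ⟨k, rfl⟩ := hα
  have e : Units.mk0 (c ^ (k + k)) (pow_ne_zero _ hc) =
      Units.mk0 ((c ^ k) ^ 2) (pow_ne_zero 2 (pow_ne_zero k hc)) :=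
    Units.ext (by rw [Units.val_mk0, Units.val_mk0, sq, pow_add])
  rw [e]
  exact Subgroup.mul_mem_cancel_left _ (sq_mem_normUnitsSubgroup (pow_ne_zero k hc))

/-- `c^α · v ∈ Nm(K_dˣ) ↔ c · v ∈ Nm(K_dˣ)` for `α` odd (`c^α = (c^k)² · c`).
research route conditional on HC_CM; not a corollary; Q11.4-sentence-2 already refuted in dim ≥ 3. [folklore] -/
theorem pow_mul_mem_iff_of_odd {d : ℕ} {c : ℚ} (hc : c ≠ 0) {α : ℕ} (hα : Odd α) (v : ℚˣ) :
    Units.mk0 (c ^ α) (pow_ne_zero α hc) * v ∈ normUnitsSubgroup ℚ (weilField d) ↔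
      Units.mk0 c hc * v ∈ normUnitsSubgroup ℚ (weilField d) := by
  obtain ⟨k, rfl⟩ := hα
  have e : Units.mk0 (c ^ (2 * k + 1)) (pow_ne_zero _ hc) =
      Units.mk0 ((c ^ k) ^ 2) (pow_ne_zero 2 (pow_ne_zero k hc)) * Units.mk0 c hc :=
    Units.ext (by
      rw [Units.val_mul, Units.val_mk0, Units.val_mk0, Units.val_mk0, pow_succ, ← pow_mul, mul_comm k 2])
  rw [e, mul_assoc]
  exact Subgroup.mul_mem_cancel_left _ (sq_mem_normUnitsSubgroup (pow_ne_zero k hc))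

/-- `c^α · v ∈ Nm ↔ v ∈ Nm` when `c` itself is a norm (any `α`).
research route conditional on HC_CM; not a corollary; Q11.4-sentence-2 already refuted in dim ≥ 3. [folklore] -/
theorem pow_mul_mem_iff_of_mem {d : ℕ} {c : ℚ} (hc : c ≠ 0)
    (h : Units.mk0 c hc ∈ normUnitsSubgroup ℚ (weilField d)) (α : ℕ) (v : ℚˣ) :
    Units.mk0 (c ^ α) (pow_ne_zero α hc) * v ∈ normUnitsSubgroup ℚ (weilField d) ↔
      v ∈ normUnitsSubgroup ℚ (weilField d) :=
  Subgroup.mul_mem_cancel_left _ (pow_mem_normUnitsSubgroup hc h α)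

/-! ### §2 `K = ℚ(√-3)` with the primes `5` and `7` -/

namespace SqrtNeg3

/-- `2^α · 5^γ ∈ Nm(ℚ(√-3)ˣ) ↔ α` and `γ` both even (`2 ∉`, `5 ∉`, `10 ∉ Nm(ℚ(√-3)ˣ)`: the classes `[2]`,
`[5]`, `[10]` are distinct non-split classes, `T = {2,3}, {3,5}, {2,5}`).
research route conditional on HC_CM; not a corollary; Q11.4-sentence-2 already refuted in dim ≥ 3. [cite: vanGeemen1994HodgeAV, (5.4.1)] -/
theorem two_pow_mul_five_pow_mem_iff (α γ : ℕ) :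
    Units.mk0 ((2 : ℚ) ^ α * 5 ^ γ) (mul_ne_zero (pow_ne_zero α two_ne_zero) (pow_ne_zero γ (by norm_num))) ∈
        normUnitsSubgroup ℚ (weilField 3) ↔ Even α ∧ Even γ := by
  rw [← mk0_mul_mk0 (pow_ne_zero α two_ne_zero) (pow_ne_zero γ (by norm_num))]
  rcases Nat.even_or_odd α with hα | hα
  · rw [pow_mul_mem_iff_of_even two_ne_zero hα, pow_mem_normUnitsSubgroup_iff_even _ five_not_mem_norm_three]
    exact ⟨fun h => ⟨hα, h⟩, fun h => h.2⟩
  · rw [pow_mul_mem_iff_of_odd two_ne_zero hα]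
    have hnot : Units.mk0 (2 : ℚ) two_ne_zero * Units.mk0 ((5 : ℚ) ^ γ) (pow_ne_zero γ (by norm_num)) ∉
        normUnitsSubgroup ℚ (weilField 3) := by
      have ec : Units.mk0 (2 : ℚ) two_ne_zero * Units.mk0 ((5 : ℚ) ^ γ) (pow_ne_zero γ (by norm_num)) =
          Units.mk0 ((5 : ℚ) ^ γ) (pow_ne_zero γ (by norm_num)) * Units.mk0 (2 : ℚ) two_ne_zero := mul_comm _ _
      rw [ec]
      rcases Nat.even_or_odd γ with hγ | hγ
      · rw [pow_mul_mem_iff_of_even (by norm_num : (5 : ℚ) ≠ 0) hγ]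
        exact two_not_mem_norm_three
      · rw [pow_mul_mem_iff_of_odd (by norm_num : (5 : ℚ) ≠ 0) hγ]
        have e : Units.mk0 (5 : ℚ) (by norm_num) * Units.mk0 (2 : ℚ) two_ne_zero = Units.mk0 (10 : ℚ) (by norm_num) :=
          Units.ext (by simp only [Units.val_mul, Units.val_mk0]; norm_num)
        rw [e]
        exact ten_not_mem_norm_three
    refine ⟨fun h => (hnot h).elim, fun h => ?_⟩
    exact ((Nat.not_even_iff_odd.mpr hα) h.1).elim

/-- `2^α · 3^β · 5^γ ∈ Nm(ℚ(√-3)ˣ) ↔ α` and `γ` even (`3` is a norm): the classes of the `ℤ/m`-Prym pieces with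
`m ∣ 90` resp. `m ∣ 60` for `K = ℚ(√-3)` — split iff `v₂`, `v₅` both even; `[2]` (R1-type), `[5]` (`T = {3,5}`),
`[10]` (`T = {2,5}`) otherwise.
research route conditional on HC_CM; not a corollary; Q11.4-sentence-2 already refuted in dim ≥ 3. [cite: vanGeemen1994HodgeAV, (5.4.1)] -/
theorem two_pow_mul_three_pow_mul_five_pow_mem_iff (α β γ : ℕ) :
    Units.mk0 ((2 : ℚ) ^ α * 3 ^ β * 5 ^ γ)
        (mul_ne_zero (mul_ne_zero (pow_ne_zero α two_ne_zero) (pow_ne_zero β three_ne_zero))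
          (pow_ne_zero γ (by norm_num))) ∈ normUnitsSubgroup ℚ (weilField 3) ↔ Even α ∧ Even γ := by
  have e : Units.mk0 ((2 : ℚ) ^ α * 3 ^ β * 5 ^ γ)
        (mul_ne_zero (mul_ne_zero (pow_ne_zero α two_ne_zero) (pow_ne_zero β three_ne_zero))
          (pow_ne_zero γ (by norm_num))) =
      Units.mk0 ((3 : ℚ) ^ β) (pow_ne_zero β three_ne_zero) *
        (Units.mk0 ((2 : ℚ) ^ α) (pow_ne_zero α two_ne_zero) * Units.mk0 ((5 : ℚ) ^ γ) (pow_ne_zero γ (by norm_num))) :=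
    Units.ext (by simp only [Units.val_mul, Units.val_mk0]; ring)
  rw [e, pow_mul_mem_iff_of_mem _ mem_3, mk0_mul_mk0]
  exact two_pow_mul_five_pow_mem_iff α γ

/-- `2^α · 3^β · 7^δ ∈ Nm(ℚ(√-3)ˣ) ↔ α` even (`3`, `7 = 2² + 3·1²` are norms, `2` is not): `ℤ/21`-, `ℤ/42`-,
`ℤ/84`-pieces for `K = ℚ(√-3)` are split iff `v₂` is even.
research route conditional on HC_CM; not a corollary; Q11.4-sentence-2 already refuted in dim ≥ 3. [cite: vanGeemen1994HodgeAV, (5.4.1)] -/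
theorem two_pow_mul_three_pow_mul_seven_pow_mem_iff (α β δ : ℕ) :
    Units.mk0 ((2 : ℚ) ^ α * 3 ^ β * 7 ^ δ)
        (mul_ne_zero (mul_ne_zero (pow_ne_zero α two_ne_zero) (pow_ne_zero β three_ne_zero))
          (pow_ne_zero δ (by norm_num))) ∈ normUnitsSubgroup ℚ (weilField 3) ↔ Even α := by
  have e : Units.mk0 ((2 : ℚ) ^ α * 3 ^ β * 7 ^ δ)
        (mul_ne_zero (mul_ne_zero (pow_ne_zero α two_ne_zero) (pow_ne_zero β three_ne_zero))
          (pow_ne_zero δ (by norm_num))) =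
      Units.mk0 ((7 : ℚ) ^ δ) (pow_ne_zero δ (by norm_num)) *
        (Units.mk0 ((3 : ℚ) ^ β) (pow_ne_zero β three_ne_zero) * Units.mk0 ((2 : ℚ) ^ α) (pow_ne_zero α two_ne_zero)) :=
    Units.ext (by simp only [Units.val_mul, Units.val_mk0]; ring)
  rw [e, pow_mul_mem_iff_of_mem _ mem_7, pow_mul_mem_iff_of_mem _ mem_3]
  exact pow_mem_normUnitsSubgroup_iff_even _ two_not_mem_norm_three α

end SqrtNeg3

/-! ### §3 `K = ℚ(√-7)` -/

namespace SqrtNeg7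

/-- `2^α · 3^β · 7^δ ∈ Nm(ℚ(√-7)ˣ) ↔ β` even (`2 = (1/2)² + 7·(1/2)²` and `7` are norms, `3` is inert): the
`ℤ/7`-, `ℤ/14`-, `ℤ/21`-, `ℤ/28`-, `ℤ/42`-, `ℤ/56`-, `ℤ/84`-Prym pieces for `K = ℚ(√-7)` are split iff `v₃` is even
(the census finds them all split), on the row `[(-1)ⁿ·3]` (`T = {3,7}`) otherwise.
research route conditional on HC_CM; not a corollary; Q11.4-sentence-2 already refuted in dim ≥ 3. [cite: vanGeemen1994HodgeAV, (5.4.1)] -/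
theorem two_pow_mul_three_pow_mul_seven_pow_mem_iff (α β δ : ℕ) :
    Units.mk0 ((2 : ℚ) ^ α * 3 ^ β * 7 ^ δ)
        (mul_ne_zero (mul_ne_zero (pow_ne_zero α two_ne_zero) (pow_ne_zero β three_ne_zero))
          (pow_ne_zero δ (by norm_num))) ∈ normUnitsSubgroup ℚ (weilField 7) ↔ Even β := by
  have e : Units.mk0 ((2 : ℚ) ^ α * 3 ^ β * 7 ^ δ)
        (mul_ne_zero (mul_ne_zero (pow_ne_zero α two_ne_zero) (pow_ne_zero β three_ne_zero))
          (pow_ne_zero δ (by norm_num))) =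
      Units.mk0 ((7 : ℚ) ^ δ) (pow_ne_zero δ (by norm_num)) *
        (Units.mk0 ((2 : ℚ) ^ α) (pow_ne_zero α two_ne_zero) * Units.mk0 ((3 : ℚ) ^ β) (pow_ne_zero β three_ne_zero)) :=
    Units.ext (by simp only [Units.val_mul, Units.val_mk0]; ring)
  rw [e, pow_mul_mem_iff_of_mem _ mem_7, pow_mul_mem_iff_of_mem _ mem_2]
  exact pow_mem_normUnitsSubgroup_iff_even _ three_not_mem_norm_seven β

/-- `2^α · 5^γ · 7^δ ∈ Nm(ℚ(√-7)ˣ) ↔ γ` even (`5` is inert in `ℚ(√-7)`): the `ℤ/35`-, `ℤ/70`-pieces for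
`K = ℚ(√-7)` are split iff `v₅` is even, on the row `[(-1)ⁿ·5]` (`T = {5,7}`; W12.7.5 ∋ the CM point
`(35; 0; 1,4,30)` of type `(1⁹,5,5,5)`) otherwise.
research route conditional on HC_CM; not a corollary; Q11.4-sentence-2 already refuted in dim ≥ 3. [cite: vanGeemen1994HodgeAV, (5.4.1)] -/
theorem two_pow_mul_five_pow_mul_seven_pow_mem_iff (α γ δ : ℕ) :
    Units.mk0 ((2 : ℚ) ^ α * 5 ^ γ * 7 ^ δ)
        (mul_ne_zero (mul_ne_zero (pow_ne_zero α two_ne_zero) (pow_ne_zero γ (by norm_num)))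
          (pow_ne_zero δ (by norm_num))) ∈ normUnitsSubgroup ℚ (weilField 7) ↔ Even γ := by
  have e : Units.mk0 ((2 : ℚ) ^ α * 5 ^ γ * 7 ^ δ)
        (mul_ne_zero (mul_ne_zero (pow_ne_zero α two_ne_zero) (pow_ne_zero γ (by norm_num)))
          (pow_ne_zero δ (by norm_num))) =
      Units.mk0 ((7 : ℚ) ^ δ) (pow_ne_zero δ (by norm_num)) *
        (Units.mk0 ((2 : ℚ) ^ α) (pow_ne_zero α two_ne_zero) * Units.mk0 ((5 : ℚ) ^ γ) (pow_ne_zero γ (by norm_num))) :=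
    Units.ext (by simp only [Units.val_mul, Units.val_mk0]; ring)
  rw [e, pow_mul_mem_iff_of_mem _ mem_7, pow_mul_mem_iff_of_mem _ mem_2]
  exact pow_mem_normUnitsSubgroup_iff_even _ five_not_mem_norm_seven γ

end SqrtNeg7

/-! ### §4 `K = ℚ(√-11)` -/

namespace SqrtNeg11

/-- `2^α · 3^β · 11^γ ∈ Nm(ℚ(√-11)ˣ) ↔ α` even (`3 = (1/2)² + 11·(1/2)²` and `11` are norms, `2` is inert): the
`ℤ/11`-, `ℤ/22`-, `ℤ/33`-, `ℤ/44`-, `ℤ/66`-Prym pieces for `K = ℚ(√-11)` are split iff `v₂` is even, on the row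
`[(-1)ⁿ·2]` (`T = {2,11}`; W10.11.2 ∋ the `ℤ/22`-curves `(0; 1,11,12,20)`, `(0; 1,11,16,16)` with `v₂ = 5`) otherwise.
research route conditional on HC_CM; not a corollary; Q11.4-sentence-2 already refuted in dim ≥ 3. [cite: vanGeemen1994HodgeAV, (5.4.1)] -/
theorem two_pow_mul_three_pow_mul_eleven_pow_mem_iff (α β γ : ℕ) :
    Units.mk0 ((2 : ℚ) ^ α * 3 ^ β * 11 ^ γ)
        (mul_ne_zero (mul_ne_zero (pow_ne_zero α two_ne_zero) (pow_ne_zero β three_ne_zero))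
          (pow_ne_zero γ (by norm_num))) ∈ normUnitsSubgroup ℚ (weilField 11) ↔ Even α := by
  have e : Units.mk0 ((2 : ℚ) ^ α * 3 ^ β * 11 ^ γ)
        (mul_ne_zero (mul_ne_zero (pow_ne_zero α two_ne_zero) (pow_ne_zero β three_ne_zero))
          (pow_ne_zero γ (by norm_num))) =
      Units.mk0 ((11 : ℚ) ^ γ) (pow_ne_zero γ (by norm_num)) *
        (Units.mk0 ((3 : ℚ) ^ β) (pow_ne_zero β three_ne_zero) * Units.mk0 ((2 : ℚ) ^ α) (pow_ne_zero α two_ne_zero)) :=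
    Units.ext (by simp only [Units.val_mul, Units.val_mk0]; ring)
  rw [e, pow_mul_mem_iff_of_mem _ mem_11, pow_mul_mem_iff_of_mem _ mem_3]
  exact pow_mem_normUnitsSubgroup_iff_even _ two_not_mem_norm_eleven α

end SqrtNeg11

/-! ### §5 `K = ℚ(i)` with the primes `5`, `7`, `11` -/

namespace SqrtNeg1

/-- `2^α · 3^β · 5^γ ∈ Nm(ℚ(i)ˣ) ↔ β` even (`2`, `5` are norms, `3` is inert): every `ℤ/m`-piece with
`4 ∣ m ∣ 180` for `K = ℚ(i)` is split iff `v₃` is even (R3-type row otherwise).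
research route conditional on HC_CM; not a corollary; Q11.4-sentence-2 already refuted in dim ≥ 3. [cite: vanGeemen1994HodgeAV, (5.4.1)] -/
theorem two_pow_mul_three_pow_mul_five_pow_mem_iff (α β γ : ℕ) :
    Units.mk0 ((2 : ℚ) ^ α * 3 ^ β * 5 ^ γ)
        (mul_ne_zero (mul_ne_zero (pow_ne_zero α two_ne_zero) (pow_ne_zero β three_ne_zero))
          (pow_ne_zero γ (by norm_num))) ∈ normUnitsSubgroup ℚ (weilField 1) ↔ Even β := by
  have e : Units.mk0 ((2 : ℚ) ^ α * 3 ^ β * 5 ^ γ)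
        (mul_ne_zero (mul_ne_zero (pow_ne_zero α two_ne_zero) (pow_ne_zero β three_ne_zero))
          (pow_ne_zero γ (by norm_num))) =
      Units.mk0 ((5 : ℚ) ^ γ) (pow_ne_zero γ (by norm_num)) *
        (Units.mk0 ((2 : ℚ) ^ α) (pow_ne_zero α two_ne_zero) * Units.mk0 ((3 : ℚ) ^ β) (pow_ne_zero β three_ne_zero)) :=
    Units.ext (by simp only [Units.val_mul, Units.val_mk0]; ring)
  rw [e, pow_mul_mem_iff_of_mem _ mem_5, pow_mul_mem_iff_of_mem _ mem_2]
  exact pow_mem_normUnitsSubgroup_iff_even _ three_not_mem_norm_one β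

/-- `2^α · 7^δ ∈ Nm(ℚ(i)ˣ) ↔ δ` even (`7` is inert): `ℤ/28`-pieces for `K = ℚ(i)` are split iff `v₇` is even
(the census finds them all split).
research route conditional on HC_CM; not a corollary; Q11.4-sentence-2 already refuted in dim ≥ 3. [cite: vanGeemen1994HodgeAV, (5.4.1)] -/
theorem two_pow_mul_seven_pow_mem_iff (α δ : ℕ) :
    Units.mk0 ((2 : ℚ) ^ α * 7 ^ δ) (mul_ne_zero (pow_ne_zero α two_ne_zero) (pow_ne_zero δ (by norm_num))) ∈
        normUnitsSubgroup ℚ (weilField 1) ↔ Even δ := by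
  rw [← mk0_mul_mk0 (pow_ne_zero α two_ne_zero) (pow_ne_zero δ (by norm_num)), pow_mul_mem_iff_of_mem _ mem_2]
  exact pow_mem_normUnitsSubgroup_iff_even _ seven_not_mem_norm_one δ

/-- `2^α · 11^ε ∈ Nm(ℚ(i)ˣ) ↔ ε` even (`11` is inert): `ℤ/44`-pieces for `K = ℚ(i)` are split iff `v₁₁` is even.
research route conditional on HC_CM; not a corollary; Q11.4-sentence-2 already refuted in dim ≥ 3. [cite: vanGeemen1994HodgeAV, (5.4.1)] -/
theorem two_pow_mul_eleven_pow_mem_iff (α ε : ℕ) :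
    Units.mk0 ((2 : ℚ) ^ α * 11 ^ ε) (mul_ne_zero (pow_ne_zero α two_ne_zero) (pow_ne_zero ε (by norm_num))) ∈
        normUnitsSubgroup ℚ (weilField 1) ↔ Even ε := by
  rw [← mk0_mul_mk0 (pow_ne_zero α two_ne_zero) (pow_ne_zero ε (by norm_num)), pow_mul_mem_iff_of_mem _ mem_2]
  exact pow_mem_normUnitsSubgroup_iff_even _ not_mem_11 ε

end SqrtNeg1

/-! ### §6 Census sentences for `ℚ(√-7)` and `ℚ(√-11)` -/

section Census

variable {ι : Type*} {E : Type*} [NormedAddCommGroup E] [NormedSpace ℂ E]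
  {Φ : (ι → ℝ) ≃L[ℝ] E} {ω : E [⋀^Fin 2]→L[ℝ] ℝ} {g : ℕ} {dtyp : Fin g → ℕ}
  {n : ℕ} {q : ℚ}

/-- **`K = ℚ(√-7)`, type `2^α 3^β 7^δ`, order-free lattice: SPLIT iff `β = v₃(d₁⋯d_g)` even** — every `ℤ/m`-Prym
piece with `7 ∣ m ∣ 84` of `ℚ(√-7)`-Weil type (census: `v₃` even on every such Weil datum with `dim ≤ 12`).
research route conditional on HC_CM; not a corollary; Q11.4-sentence-2 already refuted in dim ≥ 3. [cite: vanGeemen1994HodgeAV, (5.4.1)] -/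
theorem sqrtNeg7_mk_det_eq_split_iff_even_of_type_two_three_seven
    {a b : Matrix (Fin (2 * n)) (Fin (2 * n)) ℚ} (hd : IsPolarizationType Φ ω dtyp)
    (e : Fin (4 * n) ≃ ι) (P : Matrix (Fin (4 * n)) (Fin (4 * n)) ℤ)
    (hF : (Matrix.of fun j j' =>
        ω ![Φ (intVec fun i => P (e.symm i) j), Φ (intVec fun i => P (e.symm i) j')]) =
      (weilStdGramMatrix n 7 a b).map (Rat.cast : ℚ → ℝ))
    (ha : a.IsSymm) (hb : bᵀ = -b) (hq : (weilGramMatrix 7 a b).det = algebraMap ℚ (weilField 7) q)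
    (hsign : 0 < (-1 : ℚ) ^ n * q) (hq0 : q ≠ 0) {w : ℕ} (hidx : P.det.natAbs = w ^ 2)
    {α β δ : ℕ} (htyp : (∏ i, (dtyp i : ℚ)) = 2 ^ α * 3 ^ β * 7 ^ δ) :
    (QuotientGroup.mk (Units.mk0 q hq0) : weilNormResidueGroup 7) = splitDiscriminantClass n 7 ↔ Even β := by
  have hne : (2 : ℚ) ^ α * 3 ^ β * 7 ^ δ ≠ 0 :=
    mul_ne_zero (mul_ne_zero (pow_ne_zero α two_ne_zero) (pow_ne_zero β three_ne_zero))
      (pow_ne_zero δ (by norm_num))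
  have hprod : (∏ i, (dtyp i : ℚ)) ≠ 0 := by rw [htyp]; exact hne
  rw [mk_det_eq_splitDiscriminantClass_iff_prod_type_mem_of_index_sq hd (by norm_num) e P hF ha hb hq hsign
    hq0 hidx hprod]
  have hu : Units.mk0 (∏ i, (dtyp i : ℚ)) hprod = Units.mk0 ((2 : ℚ) ^ α * 3 ^ β * 7 ^ δ)
      (mul_ne_zero (mul_ne_zero (pow_ne_zero α two_ne_zero) (pow_ne_zero β three_ne_zero))
        (pow_ne_zero δ (by norm_num))) := Units.ext htyp
  rw [hu, SqrtNeg7.two_pow_mul_three_pow_mul_seven_pow_mem_iff]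

/-- **`K = ℚ(√-11)`, type `2^α 3^β 11^γ`, order-free lattice: SPLIT iff `α = v₂(d₁⋯d_g)` even** — every
`ℤ/m`-Prym piece with `11 ∣ m ∣ 132`, `m ∈ {11, 22, 33, 44, 66}` of `ℚ(√-11)`-Weil type; row
W10.11.2 = `(5, ℚ(√-11), [-2])` for the `ℤ/22`-curves with `v₂ = 5`.
research route conditional on HC_CM; not a corollary; Q11.4-sentence-2 already refuted in dim ≥ 3. [cite: vanGeemen1994HodgeAV, (5.4.1)] -/
theorem sqrtNeg11_mk_det_eq_split_iff_even_of_type_two_three_eleven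
    {a b : Matrix (Fin (2 * n)) (Fin (2 * n)) ℚ} (hd : IsPolarizationType Φ ω dtyp)
    (e : Fin (4 * n) ≃ ι) (P : Matrix (Fin (4 * n)) (Fin (4 * n)) ℤ)
    (hF : (Matrix.of fun j j' =>
        ω ![Φ (intVec fun i => P (e.symm i) j), Φ (intVec fun i => P (e.symm i) j')]) =
      (weilStdGramMatrix n 11 a b).map (Rat.cast : ℚ → ℝ))
    (ha : a.IsSymm) (hb : bᵀ = -b) (hq : (weilGramMatrix 11 a b).det = algebraMap ℚ (weilField 11) q)
    (hsign : 0 < (-1 : ℚ) ^ n * q) (hq0 : q ≠ 0) {w : ℕ} (hidx : P.det.natAbs = w ^ 2)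
    {α β γ : ℕ} (htyp : (∏ i, (dtyp i : ℚ)) = 2 ^ α * 3 ^ β * 11 ^ γ) :
    (QuotientGroup.mk (Units.mk0 q hq0) : weilNormResidueGroup 11) = splitDiscriminantClass n 11 ↔ Even α := by
  have hne : (2 : ℚ) ^ α * 3 ^ β * 11 ^ γ ≠ 0 :=
    mul_ne_zero (mul_ne_zero (pow_ne_zero α two_ne_zero) (pow_ne_zero β three_ne_zero))
      (pow_ne_zero γ (by norm_num))
  have hprod : (∏ i, (dtyp i : ℚ)) ≠ 0 := by rw [htyp]; exact hne
  rw [mk_det_eq_splitDiscriminantClass_iff_prod_type_mem_of_index_sq hd (by norm_num) e P hF ha hb hq hsign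
    hq0 hidx hprod]
  have hu : Units.mk0 (∏ i, (dtyp i : ℚ)) hprod = Units.mk0 ((2 : ℚ) ^ α * 3 ^ β * 11 ^ γ)
      (mul_ne_zero (mul_ne_zero (pow_ne_zero α two_ne_zero) (pow_ne_zero β three_ne_zero))
        (pow_ne_zero γ (by norm_num))) := Units.ext htyp
  rw [hu, SqrtNeg11.two_pow_mul_three_pow_mul_eleven_pow_mem_iff]

end Census

end Summit.HodgeConjecture.HodgeConjecture.Ring2.WeilCoverage
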